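/-
Origin: expansion seat `planner-pub-hodgecm-mc-axioms-1-g14-0`, handover #W223 2026-08-20T15:53:55Z md5 718bfcd76506 (PKG 9994e92650ee → 718bfcd76506; 226 l.; MECHANICAL (iib-R) rewrite v3.1 of the PKG file as it stands (31 token edits; rules R1x1+RX[h₂]x30)) (`HOME/mc/pub-hodgecm-mc-axioms-1-g14/revendor/kit-r55/stage55/HodgeCM/Model/Binders/Gen12RepOfSat.lean`, md5 718bfcd76506, 226 lines);
landed by the gen-22 packager (p-g22) in gate run 55 REPLACES the earlier landed copy of `HodgeCM/Model/Binders/Gen12RepOfSat.lean` (seat copy carried the packager Origin header of an earlier run (stripped)).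
-/
/-
Origin: speedrun cell pub-hodgecm, MODEL-CONSTRUCTION sub-cell, unit pub-hodgecm-mc-binder-1-g7 (BINDER PROVER, gen 7; node
B2-meet, BINDER-OWNERS row 14, junction (J-rep) of RECORD 1), seat prover-pub-hodgecm-mc-binder-1-g7-0, 2026-08-19
(″ (adm) re-cut the same day: the supremum ranges over the ADMISSIBLE situations `adm Γ k`, `hsat : adm ⇒ saturated at KΓ`).
Target in PKG: HodgeCM/Model/Binders/Gen12RepOfSat.lean (NEW additive leaf; imports kit #7 `Model/Binders/Gen12OfSeesaw` (binder-1-g6,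
RUN-36 kit `t36-mcbinder1g6.txt`) only; nothing landed imports it).  KERNEL ONLY: 0 records of published theorems, nothing cited,
0 `def … : Prop`, MODEL-N ±0.  World: RUN-35 pin (`Model/ThetaSpaceInputPin`, `Model/ThetaSpace`); the (Θ-sat) pin packet of
RUN 37 makes the one hypothesis `hΘ` below definitional (`thetaSpaceSatOf_le_iff`).
-/
import Summits.HodgeConjecture.HodgeCM.Model.Binders.Gen12OfSeesaw

/-!
# (J-rep) at the pin: admissible representatives of theta one-forms from SATURATION of the theta space

`Binders/Gen12OfSeesaw` leaves RECORD 1 `Gen12Residual = {Sat, rep, proj}` of row `gen12`.  Its field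

  (J-rep) `rep : ∀ Γ k (k = 0 ∨ k = 1), ∀ ω ∈ Θ_k(Γ), ∃ (cl : H¹⁰) (G ∈ span (thetaGen Γ k)), ↑cl = ω ∧ Sat Γ G ∧ pull cl = G ∘ ιinf`

asks, for every theta one-form of the pin, an ADELIC representative `G` in the span of the generating theta forms which is
saturated (`Sat Γ G`) and pulls back to the class's harmonic representative.  This file proves it is NOT an independent debt of
the theta lane beyond SATURATION OF THE THETA SPACE: for any saturation index `KΓ : Level V → Subgroup G_U(𝔸)` and the
predicate `Sat Γ G :≡ G is right-KΓ Γ-invariant` (= mc-discharge-1's `SatLevel` at `KΓ := satSubgroup V hV`, BINDER-TRIAGE §56/§57),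

* **`rep_of_saturated`** — IF the pin's classical theta space `(pinX …).Θ k Γ` is contained in the span of the restricted theta
  forms of the ADMISSIBLE `K`-type situations (`adm Γ k`, which must imply SATURATION at `KΓ Γ`: `∀ g ∈ KΓ Γ, ∃ c, S.κ c = g ∧
  S.τ c = 1`, hypothesis `hsat`; hypothesis `hΘ` — at the v2 pin
  (`Θ := thetaSpaceOf`, all situations) this is (J-sat) of §54 and not provable; at the (Θ-sat) pin of RUN 37
  (`Θ := thetaSpaceSatOf … (KΓ Γ) …` over `{S // S.IsSaturated (KΓ Γ) ∧ S.IsStrict}`, theta-3 `Model/ThetaSpaceSat`) it is `le_rfl`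
  for `adm Γ k S := S.IsSaturated (KΓ Γ) ∧ S.IsStrict`), THEN (J-rep) holds with `Sat Γ G := ∀ g, ∀ k ∈ KΓ Γ, G (g k) = G g` and the
  representatives in `span (thetaGen Γ k (adm Γ k))`.
  Proof: a class `ω ∈ Θ_k(Γ) = thetaClasses id (D Γ) (Θ k Γ)` (`Gen12Junctions.theta_eq`) has `cl` with `pull cl = F`,
  `F ∈ Θ k Γ` (tree `WeightForms.thetaClasses`, `coe_restrictHom_id`); `F` is a finite sum over saturated situations `S` of
  restrictions `θ ∘ ιinf` of adelic theta forms `θ ∈ S.thetaForms 𝓕 = span {θ(j, f)}` (`Submodule.iSup_induction'`,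
  `Submodule.mem_map`, `Submodule.span_induction`); each generator `θ(j, f)` IS an element of `thetaGen Γ k` read in
  `leftInvCont₂` (`coe_thetaForm_mem_leftInvCont₂`, kit #2), and every `θ ∈ weightForms Γ_U S.κ S.τ` is right-`KΓ Γ`-invariant
  because `θ (g · S.κ c) = S.τ c⁻¹ (θ g)` (tree `weightForms`) and saturation supplies `c` with `S.κ c = k`, `S.τ c = 1`.
* **`Gen12Residual.ofSaturated`** — RECORD 1 from `hΘ` and the (J-Λ) field `proj` at that `Sat` (mc-discharge-1's
  `Gen12Junctions.proj_of_pieceUnfolding hι` at `KΓ := satSubgroup V hV`, PKG `Model/Binders/Gen12ProjDischarge`, RUN 36 ‴ world).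

ROW 14 after this leaf and kit #9: `gen12` ⟸ `SeesawCore {τ, (SS), (SS-K)}` ⊕ (N1)₀,₁ ⊕ `hι` ⊕ `hΘ` ⊕ (J-Λ) `proj` — of which (N1),
`hι`, `hΘ` are definitional at the honest/(Θ-sat) pin and `proj` is discharged (D-1′).  Nothing here is a claim of the manuscripts
under adjudication.
-/

set_option autoImplicit false

noncomputable section

open MeasureTheory NumberField
open scoped InnerProductSpace

namespace HodgeCM.Model

open HodgeCM HodgeCM.Universe
open Literature.NumberTheory.Weil1964
open Literature.NumberTheory.Automorphic (weightForms)
open Literature.NumberTheory.Automorphic.WeightForms (ClassMapDatum thetaClasses restrictHom IsLevelCorrected IsWeightMatched)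
open Literature.AlgebraicGeometry.HodgeTheory
open Literature.NumberTheory.Automorphic.PicardCM
open Literature.NumberTheory.Transcendental (Arapura2012_Cor_15_4_6)
open HodgeCM.Model.ThetaSpace

variable (hHD : exists_isReal_hodgeModel) (hI : hodgePQ_independent_of_hodgeModel)
  (h₁ : BallQuotientUniformised)  (h₃ : CMAbelianVarietyRealised)
variable (h : Bool) (hA : Arapura2012_Cor_15_4_6)
  (W : ∀ {L : CMField} {ι₁ : L →+* ℂ} (V : HermSpace3 L ι₁) (c : SeesawCtx L), WmInput V c.D)
  (S : ∀ {L : CMField} {ι₁ : L →+* ℂ} (V : HermSpace3 L ι₁) (c : SeesawCtx L), ThetaAdelicSide V c)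
  (μ : ∀ {L : CMField}, SeesawCtx L → Fin 4 → InfinitePlace L → ℤ)
variable {L : CMField} {ι₁ : L →+* ℂ} (V : HermSpace3 L ι₁) (c : SeesawCtx L) (hV : IsAnisotropic L V.Hm)

/-- the pinned theta-space INPUT of the context (kit #2 `pinX`) -/
local notation3 "𝕏" => pinX hHD hI h₁ h₃ S V c hV

/- the ADMISSIBILITY predicate on `K`-type situations (`Gen12Residual.Adm`; at the (Θ-sat) pin: saturated at the level's compact
open and strict) and the saturation index it must imply -/
variable (adm : ∀ (Γ : Level V) (k : Fin 4),
    KTypeSituation ((pinX hHD hI h₁ h₃ S V c hV).P k) ((pinX hHD hI h₁ h₃ S V c hV).ιinf Γ)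
      ((pinX hHD hI h₁ h₃ S V c hV).Δ Γ) (pinX hHD hI h₁ h₃ S V c hV).κ₁ (pinX hHD hI h₁ h₃ S V c hV).τ₁ → Prop)

/-! ## 1. Adelic theta forms of a saturated situation are admissible and right-invariant -/

/-- **Every adelic theta form of a situation at level `Γ` is an admissible candidate**: the span `S.thetaForms 𝓕` of the generating
theta forms `θ(j, f)`, `j ∈ S.𝓙`, `f ∈ 𝓕 = (P k).weightFunctions`, read as `ℂ²`-valued functions on `G_U(𝔸)`, lies in
`span (thetaGen Γ k)` inside `leftInvCont₂` (span induction over kit #2's `coe_thetaForm_mem_leftInvCont₂`). -/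
theorem exists_mem_span_thetaGen_coe_eq (Γ : Level V) (k : Fin 4)
    (Sit : KTypeSituation ((𝕏).P k) ((𝕏).ιinf Γ) ((𝕏).Δ Γ) (𝕏).κ₁ (𝕏).τ₁) (hadm : adm Γ k Sit)
    {θ : weightForms ((𝕏).P k).ΓU Sit.κ Sit.τ} (hθ : θ ∈ Sit.thetaForms ((𝕏).P k).weightFunctions) :
    ∃ G ∈ Submodule.span ℂ (thetaGen hHD hI h₁ h₃ S V c hV Γ k (adm Γ k)),
      (G : (quotU V).G → (Fin 2 → ℂ)) = (θ : (𝕏).GU → (𝕏).W) := by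
  induction hθ using Submodule.span_induction with
  | mem x hx =>
    obtain ⟨j, hj, f, hf, rfl⟩ := hx
    exact ⟨⟨_, coe_thetaForm_mem_leftInvCont₂ hHD hI h₁ h₃ S V c hV Γ k Sit j f⟩,
      Submodule.subset_span ⟨Sit, hadm, j, hj, f, hf, rfl⟩, rfl⟩
  | zero => exact ⟨0, Submodule.zero_mem _, rfl⟩
  | add x y _ _ hx hy =>
    obtain ⟨G₁, hG₁, h₁'⟩ := hx
    obtain ⟨G₂, hG₂, h₂'⟩ := hy
    exact ⟨G₁ + G₂, Submodule.add_mem _ hG₁ hG₂, by rw [Submodule.coe_add, Submodule.coe_add, h₁', h₂']; rfl⟩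
  | smul a x _ hx =>
    obtain ⟨G, hG, hG'⟩ := hx
    exact ⟨a • G, Submodule.smul_mem _ a hG, by rw [Submodule.coe_smul, Submodule.coe_smul, hG']; rfl⟩

/-- **A weight form of a situation saturated at `KΓ` is right-`KΓ`-invariant**: `θ (g · κ c) = τ c⁻¹ (θ g)` with `κ c = k`,
`τ c = 1`. -/
theorem apply_mul_eq_of_saturated {Γ : Level V} {k : Fin 4}
    (Sit : KTypeSituation ((𝕏).P k) ((𝕏).ιinf Γ) ((𝕏).Δ Γ) (𝕏).κ₁ (𝕏).τ₁) {KΓ : Subgroup (quotU V).G}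
    (hSit : ∀ g ∈ KΓ, ∃ c : Sit.Kc, Sit.κ c = g ∧ Sit.τ c = 1)
    (θ : weightForms ((𝕏).P k).ΓU Sit.κ Sit.τ) (g : (quotU V).G) {k' : (quotU V).G} (hk' : k' ∈ KΓ) :
    (θ : (𝕏).GU → (𝕏).W) (g * k') = (θ : (𝕏).GU → (𝕏).W) g := by
  obtain ⟨c₀, hc₀, hτ⟩ := hSit k' hk'
  have hinv : Sit.τ c₀⁻¹ = 1 := by
    calc Sit.τ c₀⁻¹ = Sit.τ c₀⁻¹ * Sit.τ c₀ := by rw [hτ, mul_one]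
      _ = 1 := by rw [← map_mul, inv_mul_cancel, map_one]
  have h1 := θ.2.2 c₀ g
  rw [hinv, Module.End.one_apply, hc₀] at h1
  exact h1

/-! ## 2. (J-rep) from saturation of the theta space -/

/-- **Representatives from saturation, any type `k`.**  For a saturation index `KΓ` (model case `KΓ := satSubgroup V hV`, mc-discharge-1; under (W1) `Γ.K`):
if the pin's classical theta space of type `k` at level `Γ` lies in the span of the restrictions of the theta forms of the situations
SATURATED at `KΓ Γ` (at the (Θ-sat) pin: by definition), then every theta one-form `ω ∈ Θ_k(Γ)` has a class `cl` and an adelic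
representative `G ∈ span (thetaGen Γ k)`, right-`KΓ Γ`-invariant, with `pull cl = G ∘ ιinf` — the field `Gen12Residual.rep` at
`Sat Γ G := ∀ g, ∀ k ∈ KΓ Γ, G (g k) = G g`, VERBATIM. -/
theorem exists_rep_of_saturated (KΓ : Level V → Subgroup (quotU V).G)
    (hsat : ∀ (Γ : Level V) (k : Fin 4) (Sit : KTypeSituation ((𝕏).P k) ((𝕏).ιinf Γ) ((𝕏).Δ Γ) (𝕏).κ₁ (𝕏).τ₁),
      adm Γ k Sit → ∀ g ∈ KΓ Γ, ∃ c : Sit.Kc, Sit.κ c = g ∧ Sit.τ c = 1)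
    (Γ : Level V) (k : Fin 4)
    (hΘ : (𝕏).Θ k Γ ≤ ⨆ Sit : {Sit : KTypeSituation ((𝕏).P k) ((𝕏).ιinf Γ) ((𝕏).Δ Γ) (𝕏).κ₁ (𝕏).τ₁ // adm Γ k Sit},
        Sit.1.forms ((𝕏).P k).weightFunctions)
    (ω : (picardCMUniverse hHD hI h₁ h₃).CohC ((picardCMUniverse hHD hI h₁ h₃).pms L ι₁ V Γ) 1)
    (hω : ω ∈ (pinT hHD hI h₁ h₃ h hA W S μ).Theta V c k Γ) :
    ∃ (cl : ((𝕏).D Γ).H10) (G : (quotU V).leftInvCont₂),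
      (cl : (picardCMUniverse hHD hI h₁ h₃).CohC ((picardCMUniverse hHD hI h₁ h₃).pms L ι₁ V Γ) 1) = ω ∧
      G ∈ Submodule.span ℂ (thetaGen hHD hI h₁ h₃ S V c hV Γ k (adm Γ k)) ∧
      (∀ g : (quotU V).G, ∀ k' ∈ KΓ Γ,
        (G : (quotU V).G → (Fin 2 → ℂ)) (g * k') = (G : (quotU V).G → (Fin 2 → ℂ)) g) ∧
      ((((𝕏).D Γ).pull cl).1 : (𝕏).G₁ → (Fin 2 → ℂ)) = (G : (quotU V).G → (Fin 2 → ℂ)) ∘ ((𝕏).ιinf Γ) := by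
  rw [Gen12Junctions.theta_eq (hV := hV)] at hω
  obtain ⟨cl, hcl, F, hF, -, hpull⟩ := hω
  -- the representative: induction over the admissible supremum, then over the span of generating theta forms
  have key : ∀ F' ∈ (⨆ Sit : {Sit : KTypeSituation ((𝕏).P k) ((𝕏).ιinf Γ) ((𝕏).Δ Γ) (𝕏).κ₁ (𝕏).τ₁ // adm Γ k Sit},
        Sit.1.forms ((𝕏).P k).weightFunctions),
      ∃ G ∈ Submodule.span ℂ (thetaGen hHD hI h₁ h₃ S V c hV Γ k (adm Γ k)),
        (∀ g : (quotU V).G, ∀ k' ∈ KΓ Γ,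
          (G : (quotU V).G → (Fin 2 → ℂ)) (g * k') = (G : (quotU V).G → (Fin 2 → ℂ)) g) ∧
        (F' : (𝕏).G₁ → (𝕏).W) = (G : (quotU V).G → (Fin 2 → ℂ)) ∘ ((𝕏).ιinf Γ) := by
    intro F' hF'
    induction hF' using Submodule.iSup_induction' with
    | mem Sit F' hF' =>
      obtain ⟨θ, hθ, rfl⟩ := Submodule.mem_map.mp hF'
      obtain ⟨G, hG, hGθ⟩ := exists_mem_span_thetaGen_coe_eq hHD hI h₁ h₃ S V c hV adm Γ k Sit.1 Sit.2 hθ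
      refine ⟨G, hG, fun g k' hk' => ?_, ?_⟩
      · rw [hGθ]
        exact apply_mul_eq_of_saturated hHD hI h₁ h₃ S V c hV Sit.1 (hsat Γ k Sit.1 Sit.2) θ g hk'
      · rw [hGθ]
        rfl
    | zero => exact ⟨0, Submodule.zero_mem _, fun _ _ _ => rfl, rfl⟩
    | add F₁ F₂ _ _ ih₁ ih₂ =>
      obtain ⟨G₁, hG₁, hS₁, hE₁⟩ := ih₁
      obtain ⟨G₂, hG₂, hS₂, hE₂⟩ := ih₂
      refine ⟨G₁ + G₂, Submodule.add_mem _ hG₁ hG₂, fun g k' hk' => ?_, ?_⟩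
      · simp only [Submodule.coe_add, Pi.add_apply, hS₁ g k' hk', hS₂ g k' hk']
      · rw [Submodule.coe_add, Submodule.coe_add, hE₁, hE₂]
        rfl
  obtain ⟨G, hG, hSat, hE⟩ := key F (hΘ hF)
  refine ⟨cl, G, hcl, hG, hSat, ?_⟩
  rw [hpull]
  exact hE

/-- **(J-rep) from saturation** — the field `Gen12Residual.rep` at `Sat Γ G := ∀ g, ∀ k ∈ KΓ Γ, G (g k) = G g`, VERBATIM (types `0, 1`;
`exists_rep_of_saturated` is the same for every type `k`, as row `real34` needs it for `k = 2, 3`). -/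
theorem rep_of_saturated (KΓ : Level V → Subgroup (quotU V).G)
    (hsat : ∀ (Γ : Level V) (k : Fin 4) (Sit : KTypeSituation ((𝕏).P k) ((𝕏).ιinf Γ) ((𝕏).Δ Γ) (𝕏).κ₁ (𝕏).τ₁),
      adm Γ k Sit → ∀ g ∈ KΓ Γ, ∃ c : Sit.Kc, Sit.κ c = g ∧ Sit.τ c = 1)
    (hΘ : ∀ (Γ : Level V) (k : Fin 4), k = 0 ∨ k = 1 →
      (𝕏).Θ k Γ ≤ ⨆ Sit : {Sit : KTypeSituation ((𝕏).P k) ((𝕏).ιinf Γ) ((𝕏).Δ Γ) (𝕏).κ₁ (𝕏).τ₁ // adm Γ k Sit},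
        Sit.1.forms ((𝕏).P k).weightFunctions) :
    ∀ (Γ : Level V) (k : Fin 4), k = 0 ∨ k = 1 →
      ∀ ω ∈ (pinT hHD hI h₁ h₃ h hA W S μ).Theta V c k Γ,
        ∃ (cl : ((𝕏).D Γ).H10) (G : (quotU V).leftInvCont₂),
          (cl : (picardCMUniverse hHD hI h₁ h₃).CohC ((picardCMUniverse hHD hI h₁ h₃).pms L ι₁ V Γ) 1) = ω ∧
          G ∈ Submodule.span ℂ (thetaGen hHD hI h₁ h₃ S V c hV Γ k (adm Γ k)) ∧
          (∀ g : (quotU V).G, ∀ k' ∈ KΓ Γ,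
            (G : (quotU V).G → (Fin 2 → ℂ)) (g * k') = (G : (quotU V).G → (Fin 2 → ℂ)) g) ∧
          ((((𝕏).D Γ).pull cl).1 : (𝕏).G₁ → (Fin 2 → ℂ)) = (G : (quotU V).G → (Fin 2 → ℂ)) ∘ ((𝕏).ιinf Γ) :=
  fun Γ k hk ω hω => exists_rep_of_saturated hHD hI h₁ h₃ h hA W S μ V c hV adm KΓ hsat Γ k (hΘ Γ k hk) ω hω

/-! ## 3. RECORD 1 from saturation and (J-Λ) -/

/-- **`Gen12Residual` from saturation of the theta space and the piece projection at the same saturation index** — `Sat Γ G :=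
right-`KΓ Γ`-invariance`, `rep := rep_of_saturated`, `proj` supplied (mc-discharge-1's `Gen12Junctions.proj_of_pieceUnfolding hι`
at `KΓ := satSubgroup V hV`, whose `SatLevel V hV Γ G` is this `Sat` by `Iff.rfl`). -/
def Gen12Residual.ofSaturated (KΓ : Level V → Subgroup (quotU V).G)
    (hsat : ∀ (Γ : Level V) (k : Fin 4) (Sit : KTypeSituation ((𝕏).P k) ((𝕏).ιinf Γ) ((𝕏).Δ Γ) (𝕏).κ₁ (𝕏).τ₁),
      adm Γ k Sit → ∀ g ∈ KΓ Γ, ∃ c : Sit.Kc, Sit.κ c = g ∧ Sit.τ c = 1)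
    (hΘ : ∀ (Γ : Level V) (k : Fin 4), k = 0 ∨ k = 1 →
      (𝕏).Θ k Γ ≤ ⨆ Sit : {Sit : KTypeSituation ((𝕏).P k) ((𝕏).ιinf Γ) ((𝕏).Δ Γ) (𝕏).κ₁ (𝕏).τ₁ // adm Γ k Sit},
        Sit.1.forms ((𝕏).P k).weightFunctions)
    (proj : ∀ (Γ : Level V) (cl₁ cl₂ : ((𝕏).D Γ).H10) (G₁ G₂ : (quotU V).leftInvCont₂),
      (∀ g : (quotU V).G, ∀ k' ∈ KΓ Γ,
        (G₁ : (quotU V).G → (Fin 2 → ℂ)) (g * k') = (G₁ : (quotU V).G → (Fin 2 → ℂ)) g) →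
      (∀ g : (quotU V).G, ∀ k' ∈ KΓ Γ,
        (G₂ : (quotU V).G → (Fin 2 → ℂ)) (g * k') = (G₂ : (quotU V).G → (Fin 2 → ℂ)) g) →
      ((((𝕏).D Γ).pull cl₁).1 : (𝕏).G₁ → (Fin 2 → ℂ)) = (G₁ : (quotU V).G → (Fin 2 → ℂ)) ∘ ((𝕏).ιinf Γ) →
      ((((𝕏).D Γ).pull cl₂).1 : (𝕏).G₁ → (Fin 2 → ℂ)) = (G₂ : (quotU V).G → (Fin 2 → ℂ)) ∘ ((𝕏).ιinf Γ) →
      ∃ (a : ℂ) (p : (pinT hHD hI h₁ h₃ h hA W S μ).HG L ι₁ V), a ≠ 0 ∧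
        (pinT hHD hI h₁ h₃ h hA W S μ).Λ Γ
            (cl₁ : (picardCMUniverse hHD hI h₁ h₃).CohC ((picardCMUniverse hHD hI h₁ h₃).pms L ι₁ V Γ) 1)
            (cl₂ : (picardCMUniverse hHD hI h₁ h₃).CohC ((picardCMUniverse hHD hI h₁ h₃).pms L ι₁ V Γ) 1) = a • p ∧
        ⟪p, (quotU V).realise ((quotU V).wedge₂ G₁ G₂)⟫_ℂ = ⟪p, p⟫_ℂ) :
    Gen12Residual hHD hI h₁ h₃ h hA W S μ V c hV where
  Adm := adm
  Sat Γ G := ∀ g : (quotU V).G, ∀ k' ∈ KΓ Γ,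
    (G : (quotU V).G → (Fin 2 → ℂ)) (g * k') = (G : (quotU V).G → (Fin 2 → ℂ)) g
  rep := rep_of_saturated hHD hI h₁ h₃ h hA W S μ V c hV adm KΓ hsat hΘ
  proj := proj

end HodgeCM.Model

end
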